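import Literature.NumberTheory.Rogawski1990.CohomologicalFinComponentIsTheta                  -- `cmDatum` telescope, `toHeckeCharacter`, Weil-carrier vocabulary (as in the rung-4 sub-line)
import Literature.NumberTheory.Automorphic.UnitaryGroupPlaceInclusion                        -- ★ `localPi`, `localPiEquiv`, `inclPlace`
import Literature.NumberTheory.Automorphic.Liu2021.Def411WeilCarriersLocalIsotypyAtPlace      -- ★ `localCharOfCenter`, `commute_omegaLoc_localCenter`, `localLineInl`
import Literature.NumberTheory.Automorphic.Liu2021.Def411WeilCarriersLocalTypesOfEquiv
import Literature.NumberTheory.Automorphic.UnitaryGroupLocalCongr                            -- ★ `localCongr`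
import Literature.RepresentationTheory.Liu2021.GlobalOscillatorIsomorphismCriterion
import Literature.NumberTheory.GelbartRogawski1991.FiniteAdelicWeilCentralCoinvariantsIsotypic -- ★ `TwistedCoinv.rep`
import Literature.NumberTheory.Automorphic.IrreducibleClassesComap                          -- ★ `IrrClass.comap`
import Literature.NumberTheory.Automorphic.IrreducibleClassesConstituents                   -- ★ `IrrClass.IsConstituentOf.nonempty_equiv_of_isIrreducible`
import Summits.HodgeConjecture.CorCM.B01.Transposition.Item6OmegaChiSplitting                -- ★ B01 `OmegaChiSplitting.chiLocalSplittingsD`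
import Summits.HodgeConjecture.HodgeConjecture.Theorems.F0P2cOmegaLocalType                   -- ★ p803803: CE-L `formCongr_frame`
import Mathlib.RingTheory.SimpleModule.Isotypic                                             -- Mathlib `isotypicComponent`, `LinearEquiv.isotypicComponent_eq`
import Mathlib.RepresentationTheory.Intertwining                                            -- Mathlib `Representation.Equiv`, `IntertwiningMap.equivLinearMapAsModule`
import HarnessLib

/-!
# FLOOR-0 P2 — PKΠ RUNG 4, the shared helper TTC «THETA-TYPE CRITERION» (in-house, S; theorems only)

Cell hodgecm-mathlib (D-0151), FLOOR 0, programme P2 (theta ∕ `hdictE`); crux item H413 = stmt-HodgeConjecture-24833 (`HCCMUnconditional.H413`);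
sub-line `Cruxes/H413/Lines/F0_P2PKPiRung4.lean` v1 (F0P2-plan (g6) 2026-08-31, «PKΠ ⟸ S2♭ + GRD + RIG∞ + RIGf (+ ★LTY by name)», HOME mirror
`F0/P2/F0_P2PKPiRung4.v1.F0P2-plan-g6.lean` sha16 2daa0f0306673580).  Row dealt 08:15:17Z to seat F0P4-p07 (g5) (P4 loan hand): the SHARED HELPER
both dictionary closers GRD-(S) (F0P2-p01 (g5)) and GRD-(N) (A-p17 (g15)) end with.  THEOREMS ONLY (no `def`, no instance, no notation, no named
fact, no `sorry`); never imports a `Cruxes/…/Lines` module (O50-1 ∕ s347: the conclusion RESTATES the body of the sub-line's `ThetaTypeAt` token for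
token, so the Lines edition folds it by `exact`); `--supports stmt-HodgeConjecture-24833 --as helper`.  HC_CM is proved only modulo the printed
citations until rung 0 closes; this file discharges none of them.

WHAT TTC SAYS.  The sub-line's predicate `ThetaTypeAt L H e₁ dV hdV hdV0 g hg μ hμ χf ε v c` reads «the class `c ∈ Irr(U(H)(L⁺_v))` (D6 carrier
`(cmDatum L 3 H).Local v`, pulled back to `localPi … v` along ★ `localPiEquiv … v`) IS Liu's local theta type `X_v(μ, ε, χf) ∘ κ_v⁻¹`» in LOCAL-TYPE
currency: for every irreducible `τ` on `T : Type` of which the pulled-back class is a constituent, every `τ`-isotypic representation `ρ′` is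
`X_v(μ,ε,χf) ∘ κ_v⁻¹`-isotypic.  The CRITERION: it suffices to exhibit ONE irreducible smooth representative `τ₀` of the pulled-back class together with an
equivalence `τ₀ ≃ X_v(μ,ε,χf) ∘ κ_v⁻¹` (Mathlib `Representation.Equiv`).  Proof (three lines of generic representation theory):
* a constituent of an IRREDUCIBLE `τ` is equivalent to `τ` (★ `IrrClass.IsConstituentOf.nonempty_equiv_of_isIrreducible`: the lattice of
  subrepresentations of `τ` is simple), so `τ₀ ≃ τ`, hence `τ ≃ X_v(…) ∘ κ_v⁻¹`;
* a `Representation.Equiv τ τ'` is a `ℂ[G]`-linear isomorphism `τ.asModule ≃ₗ[ℂ[G]] τ'.asModule` (Mathlib `IntertwiningMap.equivLinearMapAsModule` +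
  bijectivity), and Mathlib's `isotypicComponent R M S = sSup {m | Nonempty (m ≃ₗ[R] S)}` only sees `S` up to `≃ₗ[R]` (`LinearEquiv.isotypicComponent_eq`);
* so `isotypicComponent ℂ[G] ρ′ τ = ⊤` gives `isotypicComponent ℂ[G] ρ′ (X_v(…) ∘ κ_v⁻¹) = ⊤`.

## Contents
* §0 (generic, any group `G`) `isotypicComponent_congr_of_equiv` (equivalent types have the same isotypic component), `isotypicComponent_eq_top_of_equiv`,
  the generic core `isotypicComponent_eq_top_of_isConstituentOf_of_mk_eq` ∕ `…_of_isConstituentOf_comap` (class of `r₀ ≃ X` a constituent of an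
  irreducible `τ` ⇒ every `τ`-isotypic `ρ′` is `X`-isotypic).
* §1 (the CM telescope of the sub-line) **`thetaTypeAt_of_equiv`** (bundled representative `r₀ : SmoothIrrep`, `IrrClass.mk r₀ = IrrClass.comap (localPiEquiv … v) c`,
  `e : r₀.ρ.Equiv (X_v(μ,ε,χf) ∘ κ_v⁻¹)` ⇒ `ThetaTypeAt … c`, conclusion = the body of `ThetaTypeAt` VERBATIM) and **`thetaTypeAt_of_equiv'`** (unbundled:
  `τ₀` on `T₀ : Type`, `hirr`, `hsm`, `IrrClass.mk ⟨T₀, τ₀, hirr, hsm⟩ = …`).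

## References
* [BushnellHenniart2006] C. Bushnell, G. Henniart, Grundlehren 335 (2006): §1.1 (`Irr(G)`), §2 (subquotients).
* [BourbakiAlgebreVIII2012] N. Bourbaki, Algèbre VIII (2012): §4 n°2 (isotypic components).
* [GelbartRogawski1991] S. Gelbart, J. Rogawski, Invent. Math. 105 (1991): §5.1 (5.1.1), Lemma 5.1.2 p. 466 (the members of `Π(ξ_v)` are theta types).
* [Liu2021] Y. Liu, Camb. J. Math. 9 (2021): Def. 4.11 (l. 2090–2096) (the local theta type `X_v(μ, ε, χ)`).
-/

set_option autoImplicit false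
-- the mandated namespace has the single-problem summit's repeated segment (`HodgeConjecture.HodgeConjecture`)
set_option linter.dupNamespace false

noncomputable section

open scoped MonoidAlgebra Matrix ComplexOrder
open NumberField MeasureTheory IsDedekindDomain

namespace Summit.HodgeConjecture.HodgeConjecture.Cruxes.H413.F0P2iThetaTypeCriterion

open Literature.NumberTheory Literature.NumberTheory.Automorphic Literature.NumberTheory.Automorphic.UnitaryGroup
open Literature.NumberTheory.Automorphic.UnitaryGroup.CotangentForms
open Literature.NumberTheory.Automorphic.IdeleClassGroup
open Literature.NumberTheory.Automorphic.Liu2021 Literature.NumberTheory.Automorphic.Liu2021.Def411WeilCarriers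
open Literature.NumberTheory.Automorphic.Liu2021.Def411WeilCarriersDoubling
open Literature.NumberTheory.GelbartRogawski1991 Literature.NumberTheory.GelbartRogawski1991.UnitaryDualPair
open Literature.NumberTheory.GelbartRogawski1991.UnitaryDualPair.WeilCoinv
open Literature.RepresentationTheory Literature.RepresentationTheory.Liu2021
open Literature.NumberTheory.Rogawski1990
open Summit.HodgeConjecture.CorCM.Transposition

/-! ## §0 Isotypic components do not distinguish EQUIVALENT types (generic) -/

section Generic

universe u

variable {G : Type u} [Group G]

/-- **Equivalent types have the same isotypic component** in the `ℂ[G]`-module of any representation `ρ`: a `Representation.Equiv τ τ'` is a bijective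
intertwining map, i.e. (Mathlib `IntertwiningMap.equivLinearMapAsModule`) a `ℂ[G]`-linear isomorphism `τ.asModule ≃ₗ[ℂ[G]] τ'.asModule`, and Mathlib's
`isotypicComponent R M S = sSup {m | Nonempty (m ≃ₗ[R] S)}` depends on `S` only up to `≃ₗ[R]` (`LinearEquiv.isotypicComponent_eq`).
[cite: BourbakiAlgebreVIII2012, VIII §4 n°2] [cite: BushnellHenniart2006, §1.1] -/
theorem isotypicComponent_congr_of_equiv {V T T' : Type*} [AddCommGroup V] [Module ℂ V] [AddCommGroup T] [Module ℂ T]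
    [AddCommGroup T'] [Module ℂ T'] (ρ : Representation ℂ G V) {τ : Representation ℂ G T} {τ' : Representation ℂ G T'}
    (E : τ.Equiv τ') :
    isotypicComponent ℂ[G] ρ.asModule τ.asModule = isotypicComponent ℂ[G] ρ.asModule τ'.asModule := by
  let f : τ.asModule →ₗ[ℂ[G]] τ'.asModule := Representation.IntertwiningMap.equivLinearMapAsModule τ τ' E.toIntertwiningMap
  have hf : Function.Bijective f := E.toLinearEquiv.bijective
  exact (LinearEquiv.ofBijective f hf).isotypicComponent_eq

/-- **Isotypy transports along an equivalence of the TYPE**: if `ρ` is `τ`-isotypic and `τ ≃ τ'` then `ρ` is `τ'`-isotypic.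
[cite: BourbakiAlgebreVIII2012, VIII §4 n°2] -/
theorem isotypicComponent_eq_top_of_equiv {V T T' : Type*} [AddCommGroup V] [Module ℂ V] [AddCommGroup T] [Module ℂ T]
    [AddCommGroup T'] [Module ℂ T'] (ρ : Representation ℂ G V) {τ : Representation ℂ G T} {τ' : Representation ℂ G T'}
    (E : τ.Equiv τ') (htop : isotypicComponent ℂ[G] ρ.asModule τ.asModule = ⊤) :
    isotypicComponent ℂ[G] ρ.asModule τ'.asModule = ⊤ := by
  rw [← isotypicComponent_congr_of_equiv ρ E]
  exact htop

variable [TopologicalSpace G]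

/-- **THETA-TYPE CRITERION, generic core.**  Let `c ∈ Irr(G)` be the class of an irreducible smooth `r₀` which is equivalent to a fixed representation
`X` (the «theta type»).  Then every irreducible `τ` of which `c` is a constituent is itself equivalent to `X` (a constituent of an IRREDUCIBLE `τ` is
`≃ τ`, ★ `IrrClass.IsConstituentOf.nonempty_equiv_of_isIrreducible`), so every `τ`-isotypic representation `ρ'` is `X`-isotypic (§0).
[cite: BushnellHenniart2006, §1.1, §2] [cite: BourbakiAlgebreVIII2012, VIII §4 n°2] -/
theorem isotypicComponent_eq_top_of_isConstituentOf_of_mk_eq {c : IrrClass G} {r₀ : SmoothIrrep G} (hr₀ : IrrClass.mk r₀ = c)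
    {VX : Type*} [AddCommGroup VX] [Module ℂ VX] {X : Representation ℂ G VX} (e₀ : r₀.ρ.Equiv X)
    {T : Type*} [AddCommGroup T] [Module ℂ T] {τ : Representation ℂ G T} [τ.IsIrreducible] (hc : c.IsConstituentOf τ)
    {W : Type*} [AddCommGroup W] [Module ℂ W] (ρ' : Representation ℂ G W)
    (htop : isotypicComponent ℂ[G] ρ'.asModule τ.asModule = ⊤) :
    isotypicComponent ℂ[G] ρ'.asModule X.asModule = ⊤ := by
  subst hr₀
  obtain ⟨e₁⟩ := hc.nonempty_equiv_of_isIrreducible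
  exact isotypicComponent_eq_top_of_equiv ρ' (e₁.symm.trans e₀) htop

/-- The same with the class given as a pull-back `IrrClass.comap e c'` along an isomorphism of topological groups `e : G ≃ₜ* G'` — the currency of D6 ∕
PKΠ rung 4 (classes of `U(H)(L⁺_v) = (cmDatum L 3 H).Local v` read on `localPi … v` through ★ `localPiEquiv … v`). [cite: BushnellHenniart2006, §1.1, §2] -/
theorem isotypicComponent_eq_top_of_isConstituentOf_comap {G' : Type u} [Group G'] [TopologicalSpace G'] (e : G ≃ₜ* G')
    {c' : IrrClass G'} {r₀ : SmoothIrrep G} (hr₀ : IrrClass.mk r₀ = IrrClass.comap e c')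
    {VX : Type*} [AddCommGroup VX] [Module ℂ VX] {X : Representation ℂ G VX} (e₀ : r₀.ρ.Equiv X)
    {T : Type*} [AddCommGroup T] [Module ℂ T] {τ : Representation ℂ G T} [τ.IsIrreducible]
    (hc : (IrrClass.comap e c').IsConstituentOf τ)
    {W : Type*} [AddCommGroup W] [Module ℂ W] (ρ' : Representation ℂ G W)
    (htop : isotypicComponent ℂ[G] ρ'.asModule τ.asModule = ⊤) :
    isotypicComponent ℂ[G] ρ'.asModule X.asModule = ⊤ :=
  isotypicComponent_eq_top_of_isConstituentOf_of_mk_eq hr₀ e₀ hc ρ' htop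

end Generic

/-! ## §1 The CM telescope of the rung-4 sub-line: `ThetaTypeAt` from ONE equivalence with the theta type -/

section CM

variable (L : Type) [Field L] [NumberField L] [IsCMField L] (H : Matrix (Fin 3) (Fin 3) L) {n' : ℕ} (e₁ : Fin 3 × Fin 1 ≃ Fin n') (dV : Fin 3 → L)
    (hdV : ∀ i, IsCMField.complexConj L (dV i) = dV i) (hdV0 : ∀ i, dV i ≠ 0) (g : GL (Fin 3) L)
    (hg : ((g : Matrix (Fin 3) (Fin 3) L).map (cmConjRingHom L))ᵀ * H * (g : Matrix (Fin 3) (Fin 3) L) = Matrix.diagonal dV)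
    (μ : Literature.NumberTheory.Automorphic.IdeleClassGroup L →ₜ* Circle) (hμ : IsConjugateSymplectic L μ)
    (χf : UnitaryGroup.finAdelicOne (↥(maximalRealSubfield L)) L (IsCMField.complexConj L) →* ℂˣ) (ε : (↥(maximalRealSubfield L))ˣ)
    (v : HeightOneSpectrum (𝓞 ↥(maximalRealSubfield L))) (c : IrrClass ((cmDatum L 3 H).Local v))

set_option synthInstance.maxHeartbeats 400000 in
set_option maxHeartbeats 8000000 in
/-- **TTC — THETA-TYPE CRITERION (bundled representative).**  If the pulled-back class `IrrClass.comap (localPiEquiv … v) c` is the class of an irreducible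
smooth `r₀` with `r₀.ρ ≃ X_v(μ, ε, χf) ∘ κ_v⁻¹`, then `ThetaTypeAt L H e₁ dV hdV hdV0 g hg μ hμ χf ε v c` holds — the conclusion below is the BODY of the
sub-line's `ThetaTypeAt` token for token (fold by `exact` in the Lines edition).  Proof: the generic core §0
`isotypicComponent_eq_top_of_isConstituentOf_comap`. [cite: GelbartRogawski1991, §5.1 (5.1.1), Lem 5.1.2 p. 466] [cite: Liu2021, Def. 4.11 (l. 2090–2096)]
[cite: BushnellHenniart2006, §1.1, §2] [cite: BourbakiAlgebreVIII2012, VIII §4 n°2] -/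
theorem thetaTypeAt_of_equiv (r₀ : SmoothIrrep ↥(localPi L (IsCMField.complexConj L) 3 H v))
    (hmk : IrrClass.mk r₀ = IrrClass.comap (localPiEquiv L (IsCMField.complexConj L) 3 H v) c)
    (e : r₀.ρ.Equiv
      (((show Representation ℂ (localPi L (IsCMField.complexConj L) 3 (Matrix.diagonal dV) v) _ from
            (TwistedCoinv.rep (localCharOfCenter (↥(maximalRealSubfield L)) L (IsCMField.complexConj L)
                (JW (↥(maximalRealSubfield L)) L ε) (JW_apply_ne_zero (↥(maximalRealSubfield L)) L ε) χf v)
              ((OmegaChiSplitting.chiLocalSplittingsD ⟨L⟩ e₁ dV hdV hdV0 (toHeckeCharacter L μ)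
                ((isOscillatorChar_toHeckeCharacter_iff μ).mpr hμ) ε).omegaLoc v)
              (commute_omegaLoc_localCenter (↥(maximalRealSubfield L)) L (IsCMField.complexConj L) 3 e₁ (Matrix.diagonal dV)
                (JW (↥(maximalRealSubfield L)) L ε) (complexConj_imagUnit L) (imagUnit_ne_zero L) (imagUnit_mul_self L)
                (realDiagonal_isSymm L dV hdV) (isSymm_TW (↥(maximalRealSubfield L)) ε) (realDiagonal_map L dV hdV).symm
                (JW_eq (↥(maximalRealSubfield L)) L ε) (JW_apply_ne_zero (↥(maximalRealSubfield L)) L ε)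
                (OmegaChiSplitting.chiLocalSplittingsD ⟨L⟩ e₁ dV hdV hdV0 (toHeckeCharacter L μ)
                  ((isOscillatorChar_toHeckeCharacter_iff μ).mpr hμ) ε) v)).comp
              (UnitaryGroup.localLineInl L (IsCMField.complexConj L) 3 e₁ (Matrix.diagonal dV) (JW (↥(maximalRealSubfield L)) L ε) v)) :
              localPi L (IsCMField.complexConj L) 3 (Matrix.diagonal dV) v →* _).comp
            (localCongr L (IsCMField.complexConj L) g one_ne_zero
              (F0P2cOmegaLocalType.formCongr_frame L H dV g hg) v).symm.toMulEquiv.toMonoidHom)) :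
    ∀ (T : Type) [AddCommGroup T] [Module ℂ T] (τ : Representation ℂ ↥(localPi L (IsCMField.complexConj L) 3 H v) T), τ.IsIrreducible →
    (IrrClass.comap (localPiEquiv L (IsCMField.complexConj L) 3 H v) c).IsConstituentOf τ →
    ∀ (W' : Type) [AddCommGroup W'] [Module ℂ W'] (ρ' : Representation ℂ ↥(localPi L (IsCMField.complexConj L) 3 H v) W'),
      isotypicComponent (MonoidAlgebra ℂ (localPi L (IsCMField.complexConj L) 3 H v)) (Representation.asModule ρ')
          (Representation.asModule τ) = ⊤ →
      isotypicComponent (MonoidAlgebra ℂ (localPi L (IsCMField.complexConj L) 3 H v)) (Representation.asModule ρ')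
        (Representation.asModule
          (((show Representation ℂ (localPi L (IsCMField.complexConj L) 3 (Matrix.diagonal dV) v) _ from
            (TwistedCoinv.rep (localCharOfCenter (↥(maximalRealSubfield L)) L (IsCMField.complexConj L)
                (JW (↥(maximalRealSubfield L)) L ε) (JW_apply_ne_zero (↥(maximalRealSubfield L)) L ε) χf v)
              ((OmegaChiSplitting.chiLocalSplittingsD ⟨L⟩ e₁ dV hdV hdV0 (toHeckeCharacter L μ)
                ((isOscillatorChar_toHeckeCharacter_iff μ).mpr hμ) ε).omegaLoc v)
              (commute_omegaLoc_localCenter (↥(maximalRealSubfield L)) L (IsCMField.complexConj L) 3 e₁ (Matrix.diagonal dV)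
                (JW (↥(maximalRealSubfield L)) L ε) (complexConj_imagUnit L) (imagUnit_ne_zero L) (imagUnit_mul_self L)
                (realDiagonal_isSymm L dV hdV) (isSymm_TW (↥(maximalRealSubfield L)) ε) (realDiagonal_map L dV hdV).symm
                (JW_eq (↥(maximalRealSubfield L)) L ε) (JW_apply_ne_zero (↥(maximalRealSubfield L)) L ε)
                (OmegaChiSplitting.chiLocalSplittingsD ⟨L⟩ e₁ dV hdV hdV0 (toHeckeCharacter L μ)
                  ((isOscillatorChar_toHeckeCharacter_iff μ).mpr hμ) ε) v)).comp
              (UnitaryGroup.localLineInl L (IsCMField.complexConj L) 3 e₁ (Matrix.diagonal dV) (JW (↥(maximalRealSubfield L)) L ε) v)) :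
              localPi L (IsCMField.complexConj L) 3 (Matrix.diagonal dV) v →* _).comp
            (localCongr L (IsCMField.complexConj L) g one_ne_zero
              (F0P2cOmegaLocalType.formCongr_frame L H dV g hg) v).symm.toMulEquiv.toMonoidHom)) = ⊤ := by
  intro T _ _ τ hτ hc W' _ _ ρ' htop
  haveI := hτ
  exact isotypicComponent_eq_top_of_isConstituentOf_comap (localPiEquiv L (IsCMField.complexConj L) 3 H v) hmk e hc ρ' htop

set_option synthInstance.maxHeartbeats 400000 in
set_option maxHeartbeats 8000000 in
/-- **TTC — THETA-TYPE CRITERION (unbundled representative)**: an irreducible smooth `τ₀` on `T₀ : Type` with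
`IrrClass.mk ⟨T₀, τ₀, hirr, hsm⟩ = IrrClass.comap (localPiEquiv … v) c` and `τ₀ ≃ X_v(μ, ε, χf) ∘ κ_v⁻¹` gives `ThetaTypeAt … μ hμ χf ε v c` (body verbatim).
[cite: GelbartRogawski1991, §5.1 (5.1.1), Lem 5.1.2 p. 466] [cite: Liu2021, Def. 4.11 (l. 2090–2096)] [cite: BushnellHenniart2006, §1.1, §2] -/
theorem thetaTypeAt_of_equiv' (T₀ : Type) [AddCommGroup T₀] [Module ℂ T₀]
    (τ₀ : Representation ℂ ↥(localPi L (IsCMField.complexConj L) 3 H v) T₀) (hirr : τ₀.IsIrreducible) (hsm : τ₀.IsSmooth)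
    (hmk : IrrClass.mk { V := T₀, ρ := τ₀, isIrreducible := hirr, isSmooth := hsm } =
      IrrClass.comap (localPiEquiv L (IsCMField.complexConj L) 3 H v) c)
    (e : τ₀.Equiv
      (((show Representation ℂ (localPi L (IsCMField.complexConj L) 3 (Matrix.diagonal dV) v) _ from
            (TwistedCoinv.rep (localCharOfCenter (↥(maximalRealSubfield L)) L (IsCMField.complexConj L)
                (JW (↥(maximalRealSubfield L)) L ε) (JW_apply_ne_zero (↥(maximalRealSubfield L)) L ε) χf v)
              ((OmegaChiSplitting.chiLocalSplittingsD ⟨L⟩ e₁ dV hdV hdV0 (toHeckeCharacter L μ)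
                ((isOscillatorChar_toHeckeCharacter_iff μ).mpr hμ) ε).omegaLoc v)
              (commute_omegaLoc_localCenter (↥(maximalRealSubfield L)) L (IsCMField.complexConj L) 3 e₁ (Matrix.diagonal dV)
                (JW (↥(maximalRealSubfield L)) L ε) (complexConj_imagUnit L) (imagUnit_ne_zero L) (imagUnit_mul_self L)
                (realDiagonal_isSymm L dV hdV) (isSymm_TW (↥(maximalRealSubfield L)) ε) (realDiagonal_map L dV hdV).symm
                (JW_eq (↥(maximalRealSubfield L)) L ε) (JW_apply_ne_zero (↥(maximalRealSubfield L)) L ε)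
                (OmegaChiSplitting.chiLocalSplittingsD ⟨L⟩ e₁ dV hdV hdV0 (toHeckeCharacter L μ)
                  ((isOscillatorChar_toHeckeCharacter_iff μ).mpr hμ) ε) v)).comp
              (UnitaryGroup.localLineInl L (IsCMField.complexConj L) 3 e₁ (Matrix.diagonal dV) (JW (↥(maximalRealSubfield L)) L ε) v)) :
              localPi L (IsCMField.complexConj L) 3 (Matrix.diagonal dV) v →* _).comp
            (localCongr L (IsCMField.complexConj L) g one_ne_zero
              (F0P2cOmegaLocalType.formCongr_frame L H dV g hg) v).symm.toMulEquiv.toMonoidHom)) :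
    ∀ (T : Type) [AddCommGroup T] [Module ℂ T] (τ : Representation ℂ ↥(localPi L (IsCMField.complexConj L) 3 H v) T), τ.IsIrreducible →
    (IrrClass.comap (localPiEquiv L (IsCMField.complexConj L) 3 H v) c).IsConstituentOf τ →
    ∀ (W' : Type) [AddCommGroup W'] [Module ℂ W'] (ρ' : Representation ℂ ↥(localPi L (IsCMField.complexConj L) 3 H v) W'),
      isotypicComponent (MonoidAlgebra ℂ (localPi L (IsCMField.complexConj L) 3 H v)) (Representation.asModule ρ')
          (Representation.asModule τ) = ⊤ →
      isotypicComponent (MonoidAlgebra ℂ (localPi L (IsCMField.complexConj L) 3 H v)) (Representation.asModule ρ')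
        (Representation.asModule
          (((show Representation ℂ (localPi L (IsCMField.complexConj L) 3 (Matrix.diagonal dV) v) _ from
            (TwistedCoinv.rep (localCharOfCenter (↥(maximalRealSubfield L)) L (IsCMField.complexConj L)
                (JW (↥(maximalRealSubfield L)) L ε) (JW_apply_ne_zero (↥(maximalRealSubfield L)) L ε) χf v)
              ((OmegaChiSplitting.chiLocalSplittingsD ⟨L⟩ e₁ dV hdV hdV0 (toHeckeCharacter L μ)
                ((isOscillatorChar_toHeckeCharacter_iff μ).mpr hμ) ε).omegaLoc v)
              (commute_omegaLoc_localCenter (↥(maximalRealSubfield L)) L (IsCMField.complexConj L) 3 e₁ (Matrix.diagonal dV)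
                (JW (↥(maximalRealSubfield L)) L ε) (complexConj_imagUnit L) (imagUnit_ne_zero L) (imagUnit_mul_self L)
                (realDiagonal_isSymm L dV hdV) (isSymm_TW (↥(maximalRealSubfield L)) ε) (realDiagonal_map L dV hdV).symm
                (JW_eq (↥(maximalRealSubfield L)) L ε) (JW_apply_ne_zero (↥(maximalRealSubfield L)) L ε)
                (OmegaChiSplitting.chiLocalSplittingsD ⟨L⟩ e₁ dV hdV hdV0 (toHeckeCharacter L μ)
                  ((isOscillatorChar_toHeckeCharacter_iff μ).mpr hμ) ε) v)).comp
              (UnitaryGroup.localLineInl L (IsCMField.complexConj L) 3 e₁ (Matrix.diagonal dV) (JW (↥(maximalRealSubfield L)) L ε) v)) :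
              localPi L (IsCMField.complexConj L) 3 (Matrix.diagonal dV) v →* _).comp
            (localCongr L (IsCMField.complexConj L) g one_ne_zero
              (F0P2cOmegaLocalType.formCongr_frame L H dV g hg) v).symm.toMulEquiv.toMonoidHom)) = ⊤ :=
  thetaTypeAt_of_equiv L H e₁ dV hdV hdV0 g hg μ hμ χf ε v c { V := T₀, ρ := τ₀, isIrreducible := hirr, isSmooth := hsm } hmk e

end CM

end Summit.HodgeConjecture.HodgeConjecture.Cruxes.H413.F0P2iThetaTypeCriterion

end
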